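/-
Copyright: statement-level skeleton of a published paper (lit-balaban cell, Phase-2 proof seat p30). No proof claims
beyond what the kernel checks below.
-/
import Mathlib

/-!
# `BalabanImbrieJaffe1984to88.BIJ85Eq427Proof` — T. Bałaban, J. Imbrie, A. Jaffe, *Renormalization of the Higgs model:
minimizers, propagators and the stability of mean field theory*, Commun. Math. Phys. **97** (1985) 299–329
[BalabanImbrieJaffe1985]: **(4.2.6)–(4.2.7)** p. 310–311 *"½⟨f^{(k)},σ_kf^{(k)}⟩ = ½‖f_k‖². This identity is a consequence of
the fact that ∂G_{k,Ax}∂^* is a projection operator"* and **Remarks 1–2 p. 317, (5.2.10)–(5.2.12)**, PROVED as operator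
algebra

statement-level skeleton of published theorems with citation tags; proofs where landed; nothing here is a claim about the Yang–Mills mass gap

PDF held: `paper:balaban1985-cmp97-bij-higgs-minimizers` (journal page = PDF page + 298).  Renders read as images: p. 310,
311 (`run/shared/lean/pub/pub-balaban/t4/b2b-balaban-t4-lit2/renders/bij1985/…-p012,p013-x2.png`), p. 317
(`HOME/lit-balaban-r15/pages/1985-cmp97-bij-higgs-minimizers-p019-x2.png`).

CITATION HEADER (lean-in-tree rule).  Part of the lit-balaban TYPED SKELETON (HOME `run/shared/lean/pub/lit-balaban/`):
WHAT IS REPRODUCED = the identity (4.2.7) of row **C1.Eq4.2.4-4.2.7** (typed: `BIJ85Sect4Statements.GaugeRG.normSqP`) and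
row **C1.Rem@317** ((5.2.10)–(5.2.12)) of `HOME/lit-balaban-r15/ROWS-C1.md`; sibling of `BIJ85Eq611Proof` ((6.1.1), reserve
R6) and `BIJ85Eq625Proof` ((6.2.5)); seat p30, unit `lit-balaban-p30`.

THE PRINTED TEXT (verbatim).  p. 310 [PDF 12]: *"We also use a field f_k which lives on the η = L^{−k} lattice and is defined
by f_k = (I − ∂G_{k,Ax}∂^*)Q^{e*}_kf^{(k)}. (4.2.6) Thus f_k(p) is a function with p ∈ T_η. The action (4.2.5) also can be written
½⟨f^{(k)},σ_kf^{(k)}⟩ = ½‖f_k‖². (4.2.7)"*; p. 311 [PDF 13]: *"This identity is a consequence of the fact that ∂G_{k,Ax}∂^* is a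
projection operator. Alternatively, we compute from (4.1.1) and (4.2.1) that exp(−½⟨f,σ_kf⟩) = exp(½⟨∂^*Q^{e*}_kf,
G_{k,Ax}∂^*Q^{e*}_kf⟩)exp(−½‖Q^{e*}_kf‖²), from which (4.2.7) follows."*  p. 317 [PDF 19]: *"Remark 1. A consequence of the
proposition is ∂G_{k,Ax}∂^* = ∂𝒟_k∂^*. (5.2.10)  Remark 2. The gauge field quadratic form ⟨f^{(k)},σ_kf^{(k)}⟩ can now be
written entirely as a function of the η-lattice gauge field u_k. In fact ⟨f^{(k)},σ_kf^{(k)}⟩ = Σ_{p∈T_η} η^d|f_k(p)|², (5.2.11)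
where f_k(p) = (ie_kη²)^{−1} ln u_k(∂p). (5.2.12) This follows from the definition (4.5.4) of u_k, giving u_k(∂p) = exp[ie_kη²
Q^{e*}_kf^{(k)} − ie_kη²∂𝒟_k∂^*Q^{e*}_kf^{(k)}]. From this and (5.2.10) we get (ie_kη²)^{−1} ln u_k(∂p) = Q^{e*}_kf^{(k)} −
∂G_{k,Ax}∂^*Q^{e*}_kf^{(k)}, coinciding with (4.2.6)."*  Inputs quoted: (4.2.2) p. 310 *"σ_k = Q^e_k(I − ∂G_{k,Ax}∂^*)Q^{e*}_k"*;
(5.2.6) p. 316 *"G_{k,Ax}∂^* − 𝒟_k∂^* = ∂D"* (Prop. 5.2.2; tree: `BIJ85Sect4Statements.Prop522Data.Prop522`); (2.20) p. 305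
*"⟨f, g⟩_a = Σ_p a^d f_p g_p"* (so Σ_{p∈T_η}η^d|f_k(p)|² = ‖f_k‖²_η).

THE TYPING (pure operator algebra, as in `BIJ85Eq611Proof`; `P₁` unit-lattice plaquette fields, `Pη` η-lattice plaquette
fields with the inner product (2.20), `A` η-lattice (Lie-algebra) bond fields, `Gf` gauge functions; `dη`/`dηs` = ∂/∂^*,
`G` = G_{k,Ax}, `Dk` = 𝒟_k, `Qek`/`Qeks` = Q^e_k/Q^{e*}_k, `σk` = σ_k, `dg` = ∂ on gauge functions, `Dg` = D of (5.2.6)).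
Hypotheses, each a printed input: adjointness `hd`/`hQek`, (4.2.2) `h422`, "∂G_{k,Ax}∂^* is a projection operator" as
idempotence `hproj` (its symmetry follows from the symmetry `hG` of the covariance G_{k,Ax}, (4.1.1)), (5.2.6) `h526`, and
∂∂ = 0 (the curl of a gradient vanishes — the lattice identity behind "∂G∂^* − ∂𝒟∂^* = ∂∂D = 0") `hdd`; for Remark 2 the
plaquette holonomy of u_k in the Lie algebra, *"u_k(∂p) = exp[ie_kη²Q^{e*}_kf^{(k)} − ie_kη²∂𝒟_k∂^*Q^{e*}_kf^{(k)}]"*, enters as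
the field `hol` with `hhol` (the exponential/logarithm and the factor (ie_kη²)^{−1} are the instance's).  WHAT IS PROVED:
`proj_symm` (∂G∂^* symmetric), **`eq427`** ((4.2.7) from the projection property, via the "alternative"
computation of p. 311, cf. `BIJ85Eq611Proof.inner_sigma`), **`eq5210`** (Remark 1), `eq5212` ((5.2.12) "coinciding with (4.2.6)"), `eq5211`
((5.2.11)).  Carrier clauses (F6): the functional integrals (4.1.1), (4.2.1), the lattice maps, u_k itself ((4.5.4)) and the
logarithm in (5.2.12) are the instance's; NOTHING of the paper is asserted beyond the kernel-checked algebra below.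
-/

open scoped RealInnerProductSpace

namespace Literature.MathematicalPhysics.QuantumFieldTheory.BalabanImbrieJaffe1984to88.BIJ85Eq427Proof

variable {P₁ : Type*} [NormedAddCommGroup P₁] [InnerProductSpace ℝ P₁]
variable {A : Type*} [NormedAddCommGroup A] [InnerProductSpace ℝ A]
variable {Pη : Type*} [NormedAddCommGroup Pη] [InnerProductSpace ℝ Pη]
variable {Gf : Type*} [AddCommGroup Gf] [Module ℝ Gf]

/-! ## (4.2.6)–(4.2.7): "∂G_{k,Ax}∂^* is a projection operator" -/

/-- The operator ∂G_{k,Ax}∂^* on η-lattice plaquette fields is SYMMETRIC in the inner product (2.20): ⟨∂G∂^*p, q⟩ =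
⟨p, ∂G∂^*q⟩ — from the adjointness of ∂, ∂^* and the symmetry of the covariance G_{k,Ax} ((4.1.1)); together with
idempotence this is p. 311's *"∂G_{k,Ax}∂^* is a projection operator"* (an orthogonal projection).
[cite: BalabanImbrieJaffe1985, (4.2.7) p.311] -/
theorem proj_symm (dη : A →ₗ[ℝ] Pη) (dηs : Pη →ₗ[ℝ] A) (hd : ∀ a p, ⟪dη a, p⟫ = ⟪a, dηs p⟫) (G : A →ₗ[ℝ] A)
    (hG : ∀ a a', ⟪G a, a'⟫ = ⟪a, G a'⟫) (p q : Pη) :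
    ⟪dη (G (dηs p)), q⟫ = ⟪p, dη (G (dηs q))⟫ := by
  rw [hd, hG, real_inner_comm (dη (G (dηs q))) p, hd, real_inner_comm (dηs p) (G (dηs q))]

/-- **(4.2.6)–(4.2.7)** pp. 310–311 [PDF 12–13], verbatim: *"f_k = (I − ∂G_{k,Ax}∂^*)Q^{e*}_kf^{(k)}. (4.2.6) … The action (4.2.5)
also can be written ½⟨f^{(k)},σ_kf^{(k)}⟩ = ½‖f_k‖². (4.2.7) This identity is a consequence of the fact that ∂G_{k,Ax}∂^* is a
projection operator."* — PROVED: with σ_k = Q^e_k(I − ∂G_{k,Ax}∂^*)Q^{e*}_k ((4.2.2), `h422`), f_k as in (4.2.6) (`h426`) and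
∂G_{k,Ax}∂^* idempotent (`hproj`; symmetric by `proj_symm`), ½⟨f,σ_kf⟩ = ½‖f_k‖²; the left side is evaluated as in
`BIJ85Eq611Proof.inner_sigma`, which is exactly the "alternative" computation of p. 311 (⟨f,σ_kf⟩ = ‖Q^{e*}_kf‖² −
⟨∂^*Q^{e*}_kf, G_{k,Ax}∂^*Q^{e*}_kf⟩). [cite: BalabanImbrieJaffe1985, (4.2.6)–(4.2.7) pp.310–311] -/
theorem eq427 (dη : A →ₗ[ℝ] Pη) (dηs : Pη →ₗ[ℝ] A) (hd : ∀ a p, ⟪dη a, p⟫ = ⟪a, dηs p⟫) (G : A →ₗ[ℝ] A)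
    (hG : ∀ a a', ⟪G a, a'⟫ = ⟪a, G a'⟫) (Qek : Pη →ₗ[ℝ] P₁) (Qeks : P₁ →ₗ[ℝ] Pη)
    (hQek : ∀ p f, ⟪Qek p, f⟫ = ⟪p, Qeks f⟫) (σk : P₁ →ₗ[ℝ] P₁)
    (h422 : σk = Qek ∘ₗ (LinearMap.id - dη ∘ₗ G ∘ₗ dηs) ∘ₗ Qeks)
    (hproj : ∀ p : Pη, dη (G (dηs (dη (G (dηs p))))) = dη (G (dηs p)))
    (f : P₁) (fk : Pη) (h426 : fk = Qeks f - dη (G (dηs (Qeks f)))) :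
    (1 / 2) * ⟪f, σk f⟫ = (1 / 2) * ‖fk‖ ^ 2 := by
  -- ⟨f, σ_kf⟩ = ‖Q^{e*}_kf‖² − ⟨∂^*Q^{e*}_kf, G_{k,Ax}∂^*Q^{e*}_kf⟩ (the "alternative" computation p. 311; cf. `BIJ85Eq611Proof.inner_sigma`)
  have hval : ⟪f, σk f⟫ = ⟪Qeks f, Qeks f⟫ - ⟪dηs (Qeks f), G (dηs (Qeks f))⟫ := by
    rw [h422]
    simp only [LinearMap.comp_apply, LinearMap.sub_apply, LinearMap.id_apply]
    rw [real_inner_comm (Qek (Qeks f - dη (G (dηs (Qeks f))))) f, hQek,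
      real_inner_comm (Qeks f) (Qeks f - dη (G (dηs (Qeks f)))), inner_sub_right,
      real_inner_comm (dη (G (dηs (Qeks f)))) (Qeks f), hd, real_inner_comm (dηs (Qeks f)) (G (dηs (Qeks f)))]
  rw [hval, h426, ← real_inner_self_eq_norm_sq, inner_sub_left,
    inner_sub_right, inner_sub_right, proj_symm dη dηs hd G hG (Qeks f) (dη (G (dηs (Qeks f)))), hproj,
    proj_symm dη dηs hd G hG (Qeks f) (Qeks f), real_inner_comm (dη (G (dηs (Qeks f)))) (Qeks f),
    hd (G (dηs (Qeks f))) (Qeks f), hG (dηs (Qeks f)) (dηs (Qeks f))]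
  ring

/-! ## Remarks 1–2 p. 317: (5.2.10)–(5.2.12) -/

/-- **(5.2.10)** p. 317 [PDF 19], verbatim: *"Remark 1. A consequence of the proposition is ∂G_{k,Ax}∂^* = ∂𝒟_k∂^*. (5.2.10)"* —
PROVED from Proposition 5.2.2 (5.2.6) G_{k,Ax}∂^* − 𝒟_k∂^* = ∂D (`h526`) and ∂∂ = 0 on gauge functions (`hdd`, the curl of a
gradient). [cite: BalabanImbrieJaffe1985, (5.2.10) p.317] -/
theorem eq5210 (dη : A →ₗ[ℝ] Pη) (dηs : Pη →ₗ[ℝ] A) (G Dk : A →ₗ[ℝ] A) (dg : Gf →ₗ[ℝ] A) (Dg : Pη →ₗ[ℝ] Gf)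
    (h526 : ∀ J : Pη, G (dηs J) - Dk (dηs J) = dg (Dg J)) (hdd : dη ∘ₗ dg = 0) :
    dη ∘ₗ G ∘ₗ dηs = dη ∘ₗ Dk ∘ₗ dηs := by
  ext J
  have h0 : dη (dg (Dg J)) = 0 := by simpa using LinearMap.congr_fun hdd (Dg J)
  have h : dη (G (dηs J)) - dη (Dk (dηs J)) = 0 := by rw [← map_sub, h526, h0]
  simpa [LinearMap.comp_apply] using sub_eq_zero.mp h

/-- **(5.2.12)** p. 317 [PDF 19], verbatim: *"f_k(p) = (ie_kη²)^{−1} ln u_k(∂p). (5.2.12) This follows from the definition (4.5.4)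
of u_k, giving u_k(∂p) = exp[ie_kη²Q^{e*}_kf^{(k)} − ie_kη²∂𝒟_k∂^*Q^{e*}_kf^{(k)}]. From this and (5.2.10) we get (ie_kη²)^{−1}
ln u_k(∂p) = Q^{e*}_kf^{(k)} − ∂G_{k,Ax}∂^*Q^{e*}_kf^{(k)}, coinciding with (4.2.6)."* — PROVED in the Lie algebra: if the
(rescaled logarithm of the) plaquette holonomy of u_k is `hol` = Q^{e*}_kf^{(k)} − ∂𝒟_k∂^*Q^{e*}_kf^{(k)} (`hhol`), then by
(5.2.10) (`h526`, `hdd`) it equals (4.2.6)'s f_k = Q^{e*}_kf^{(k)} − ∂G_{k,Ax}∂^*Q^{e*}_kf^{(k)}.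
[cite: BalabanImbrieJaffe1985, (5.2.12) p.317] -/
theorem eq5212 (dη : A →ₗ[ℝ] Pη) (dηs : Pη →ₗ[ℝ] A) (G Dk : A →ₗ[ℝ] A) (dg : Gf →ₗ[ℝ] A) (Dg : Pη →ₗ[ℝ] Gf)
    (Qeks : P₁ →ₗ[ℝ] Pη) (h526 : ∀ J : Pη, G (dηs J) - Dk (dηs J) = dg (Dg J)) (hdd : dη ∘ₗ dg = 0)
    (f : P₁) (hol : Pη) (hhol : hol = Qeks f - dη (Dk (dηs (Qeks f)))) :
    hol = Qeks f - dη (G (dηs (Qeks f))) := by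
  have h := LinearMap.congr_fun (eq5210 dη dηs G Dk dg Dg h526 hdd) (Qeks f)
  simp only [LinearMap.comp_apply] at h
  rw [hhol, h]

/-- **(5.2.11)** p. 317 [PDF 19], verbatim: *"Remark 2. The gauge field quadratic form ⟨f^{(k)},σ_kf^{(k)}⟩ can now be written
entirely as a function of the η-lattice gauge field u_k. In fact ⟨f^{(k)},σ_kf^{(k)}⟩ = Σ_{p∈T_η} η^d|f_k(p)|², (5.2.11) where
f_k(p) = (ie_kη²)^{−1} ln u_k(∂p). (5.2.12)"* — PROVED: with Σ_{p∈T_η}η^d|f_k(p)|² = ‖f_k‖² in the inner product (2.20) of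
η-lattice plaquette fields, ⟨f,σ_kf⟩ = ‖hol‖² for the holonomy field `hol` of (5.2.12) (`hhol`), from (5.2.12)/(4.2.6) and
(4.2.7) (`eq427`: σ_k by (4.2.2), ∂G_{k,Ax}∂^* a projection). [cite: BalabanImbrieJaffe1985, (5.2.11) p.317] -/
theorem eq5211 (dη : A →ₗ[ℝ] Pη) (dηs : Pη →ₗ[ℝ] A) (hd : ∀ a p, ⟪dη a, p⟫ = ⟪a, dηs p⟫) (G Dk : A →ₗ[ℝ] A)
    (hG : ∀ a a', ⟪G a, a'⟫ = ⟪a, G a'⟫) (dg : Gf →ₗ[ℝ] A) (Dg : Pη →ₗ[ℝ] Gf) (Qek : Pη →ₗ[ℝ] P₁)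
    (Qeks : P₁ →ₗ[ℝ] Pη) (hQek : ∀ p f, ⟪Qek p, f⟫ = ⟪p, Qeks f⟫) (σk : P₁ →ₗ[ℝ] P₁)
    (h422 : σk = Qek ∘ₗ (LinearMap.id - dη ∘ₗ G ∘ₗ dηs) ∘ₗ Qeks)
    (hproj : ∀ p : Pη, dη (G (dηs (dη (G (dηs p))))) = dη (G (dηs p)))
    (h526 : ∀ J : Pη, G (dηs J) - Dk (dηs J) = dg (Dg J)) (hdd : dη ∘ₗ dg = 0)
    (f : P₁) (hol : Pη) (hhol : hol = Qeks f - dη (Dk (dηs (Qeks f)))) :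
    ⟪f, σk f⟫ = ‖hol‖ ^ 2 := by
  have h := eq427 dη dηs hd G hG Qek Qeks hQek σk h422 hproj f hol
    (eq5212 dη dηs G Dk dg Dg Qeks h526 hdd f hol hhol)
  linarith

end Literature.MathematicalPhysics.QuantumFieldTheory.BalabanImbrieJaffe1984to88.BIJ85Eq427Proof
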